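import Summits.ResolutionOfSingularities.ResolutionOfSingularities.Theses.IndSmooth
import Literature.AlgebraicGeometry.Resolution.SmoothImpliesRegular
import Literature.AlgebraicGeometry.Resolution.LocalUniformization
import Mathlib.RingTheory.Smooth.Locus
import HarnessLib

/-!
# A retract of a smooth chart is regular at the centre
# (crux `IndSmooth.SmoothToUniformizing`, line `birth`, stub `stub_retractRegular`)

Stub `stub_retractRegular` of the skeleton `Lines/birth.lean` (v5, the chart calculus) for crux
stmt-ResolutionOfSingularities-16088 (`Summit.…Theses.IndSmooth.SmoothToUniformizing`), route
`ResolutionOfSingularities/IndSmooth`. It is the step "TowerStabilises → RetractRegular" of the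
planner's split: once the tower of images of smooth charts stabilises at a finitely generated level
`B ⊆ O`, i.e. `B` carries a smooth chart `B → T → K` whose image lies in `B` (so that `B` is a
`k`-algebra RETRACT of the smooth `k`-algebra `T`), the level `B` is regular at the centre of `O`.

Setting: `k ⊆ K` fields, `O` a valuation subring of `K`, `B ⊆ O` a finitely generated
`k`-subalgebra of `K`, `T` a smooth `k`-algebra with `k`-algebra maps `ψ : B → T`, `χ : T → K`
such that `χ (ψ b) = b` and `χ(T) ⊆ B`. **Then `B` localized at the centre `𝔪_O ∩ B` is a
regular local ring.**

Proof (characteristic free; perfectness of `k` is not needed):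

1. Restricting the codomain, `χ` is a `k`-algebra map `χB : T → B` with `χB ∘ ψ = id_B`: `B` is a
   retract of `T`.
2. A retract of a formally smooth algebra is formally smooth (`formallySmooth_of_retract`): by
   Mathlib's section criterion `Algebra.FormallySmooth.of_split` (for a map `f : P → A` from a
   formally smooth `P`, `A` is formally smooth as soon as `P/J² → A`, `J = ker f`, has a section),
   applied to `f = χB` with the section `B → T → T/J²` induced by `ψ`.
3. `B` is of finite type, hence finitely presented, over the (Noetherian) field `k`; so `B` is
   smooth over `k`, in particular smooth at the centre `𝔭 = 𝔪_O ∩ B` (`B_𝔭` is formally smooth,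
   formal smoothness being stable under localization).
4. Smooth at a prime over a field ⇒ the local ring is regular (EGA IV 17.5.8 (iii), field case;
   Görtz–Wedhorn Lemma 6.26), the tree's `isRegularLocalRing_of_isSmoothAt`.

References: The Stacks Project, Tag 031I (the section criterion for formal smoothness, Mathlib's
`Algebra.FormallySmooth.iff_split_injection` / `of_split`); U. Görtz, T. Wedhorn, *Algebraic
Geometry I*, 2nd ed. (2020), Lemma 6.26 (p. 196).
-/

noncomputable section

-- single-problem summit: the doubled namespace component `ResolutionOfSingularities` is forced
set_option linter.dupNamespace false

open IsLocalRing
open Literature.AlgebraicGeometry.Resolution (centreIdeal isRegularLocalRing_of_isSmoothAt)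

namespace Summit.ResolutionOfSingularities.ResolutionOfSingularities.Theorems.IndSmoothBirth

/-- **A retract of a formally smooth algebra is formally smooth.** If `T` is a formally smooth
`k`-algebra and `ψ : A → T`, `ρ : T → A` are `k`-algebra maps with `ρ ∘ ψ = id_A`, then `A` is
formally smooth over `k`. Proof: the surjection `ρ` factors as `T → T/J² → A` (`J = ker ρ`), and
`A → T → T/J²` (through `ψ`) is a section of `T/J² → A`; conclude by the section criterion for
formal smoothness (Stacks 031I, Mathlib's `Algebra.FormallySmooth.of_split`). [folklore] -/
theorem formallySmooth_of_retract {k A T : Type*} [CommRing k] [CommRing A] [Algebra k A]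
    [CommRing T] [Algebra k T] [Algebra.FormallySmooth k T] (ψ : A →ₐ[k] T) (ρ : T →ₐ[k] A)
    (h : ∀ a : A, ρ (ψ a) = a) : Algebra.FormallySmooth k A :=
  Algebra.FormallySmooth.of_split ρ ((Ideal.Quotient.mkₐ k _).comp ψ) <| by
    ext a
    change ρ.kerSquareLift (Ideal.Quotient.mk _ (ψ a)) = a
    rw [AlgHom.kerSquareLift_mk, h]

/-- **Stub `stub_retractRegular` (line `birth`): a finitely generated level `B ⊆ O` which is a
`k`-algebra retract of a smooth `k`-algebra is regular at the centre.** For fields `k ⊆ K`, a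
valuation subring `O` of `K`, a finitely generated `k`-subalgebra `B ⊆ O` of `K`, and a smooth
`k`-algebra `T` with `k`-algebra maps `ψ : B → T`, `χ : T → K` such that `χ (ψ b) = b` for all
`b ∈ B` and `χ(T) ⊆ B`, the localization of `B` at the centre `𝔪_O ∩ B` is a regular local ring.
Proof: the codomain restriction `χB : T → B` of `χ` retracts `ψ`, so `B` is formally smooth over
`k` (`formallySmooth_of_retract`); `B` is finitely presented over the field `k`, hence smooth,
hence smooth at the centre; and smooth at a prime over a field means the local ring is regular
(EGA IV 17.5.8 (iii); Görtz–Wedhorn, Lemma 6.26 — the tree's `isRegularLocalRing_of_isSmoothAt`).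
Characteristic free; no perfectness of `k` is used. [cite: GortzWedhorn2020, Lemma 6.26 (p. 196)] -/
theorem stub_retractRegular (k K : Type) [Field k] [Field K] [Algebra k K] (O : ValuationSubring K)
    (B : Subalgebra k K) (h : B.toSubring ≤ O.toSubring) (hB : B.FG)
    (T : Type) [CommRing T] [Algebra k T] [Algebra.Smooth k T] (ψ : B →ₐ[k] T) (χ : T →ₐ[k] K)
    (hψχ : ∀ b : B, χ (ψ b) = (b : K)) (hrange : ∀ t : T, χ t ∈ B) :
    IsRegularLocalRing (Localization.AtPrime
      (Ideal.comap (Subring.inclusion h) (IsLocalRing.maximalIdeal O))) := by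
  -- (1) the retraction `χB : T → B`, `χB ∘ ψ = id`
  let χB : T →ₐ[k] B := χ.codRestrict B hrange
  have hret : ∀ b : B, χB (ψ b) = b := fun b => Subtype.ext (hψχ b)
  -- (2) `B` is formally smooth over `k`: a retract of the (formally) smooth `T`
  haveI : Algebra.FormallySmooth k B := formallySmooth_of_retract ψ χB hret
  -- (3) `B` is finitely presented over the Noetherian ring `k`
  haveI : Algebra.FiniteType k B := ⟨B.fg_top.mpr hB⟩
  haveI : Algebra.FinitePresentation k B :=
    Algebra.FinitePresentation.of_finiteType.mp inferInstance
  -- the centre, as a prime ideal of the type `↥B`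
  let 𝔭 : Ideal B := centreIdeal B O h
  haveI : 𝔭.IsPrime := inferInstance
  -- (4) smooth at `𝔭` (formal smoothness localizes), hence regular
  haveI : Algebra.IsSmoothAt k 𝔭 := inferInstance
  exact isRegularLocalRing_of_isSmoothAt k B 𝔭

end Summit.ResolutionOfSingularities.ResolutionOfSingularities.Theorems.IndSmoothBirth

end
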